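import Literature.Analysis.FluidPDE.HardSphereDynamicsProofs
import Literature.Analysis.FluidPDE.HardSphereFreeStretch

/-!
# Anchored covering, prelim 2: first divergence of a particle between two hard-sphere worlds

Prelim file of the registered stub `stub_anchoredCovering` (line `true-anchored-infection` of the
crux `InfluenceLocality`, stmt-AtomisticToContinuum-13916). Two hard-sphere trajectories on the
flat torus are compared particle by particle: the TRUE world `Γ` (`N` spheres) and a FORECAST
world `F` (`k` spheres), the forecast particle `m` being the true particle `e m` (`e` injective),
with the same initial states (`F 0 m = Γ 0 (e m)`).

* `infected Γ F e` — the set of particles `m` whose states in the two worlds differ at some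
  time `t ≥ 0`; `infTime Γ F e m` — the infimum `τ_m` of those times (INFECTION TIME);
  `fresh Γ F e τ` — the set of particles whose two states agree on `[0, τ)`.
* `ne_at_infTime`, `infTime_pos` — the infection time is attained (both worlds are right
  free flights immediately after any time, so agreement AT a time propagates a bit further) and
  is positive; `fst_eq_of_mem_fresh`, `leftLim_eq_of_mem_fresh` — a fresh particle has the same
  position and the same left limit in both worlds at `τ` (positions are continuous; Hausdorff
  limits).
* **`exists_carrier`** (NoSourceNoBadness; registered form `anchoredCovering_noSourceNoBadness`)
  — an infection is a CONTACT with a source: at `τ_m`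
  the receiver `m` touches, in `Γ`, an OUTSIDER `c ∉ range e`, or it touches, in `Γ` or in `F`,
  a member `m'` that was infected strictly earlier (`τ_{m'} < τ_m`). Indeed a contact between two
  fresh particles happens in both worlds at once with the same pre-collisional states, and the
  elastic reflection `collidePair` only reads those two states, so it cannot infect; and without
  a contact of `m` in either world the state of `m` does not jump (binary collisions).
-/

namespace Summit.AtomisticToContinuum.HydrodynamicLimit.Theorems.TrueAnchoredInfection

open Set Filter Topology Function
open Literature.Analysis Literature.Analysis.FluidPDE

noncomputable section

variable {d : Type*} {ε : ℝ} {N k : ℕ}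

/-! ## Infection times -/

section Defs

/-- The INFECTED particles of the forecast world: those whose true and forecast states differ at
some time `t ≥ 0`. -/
def infected (Γ : ℝ → Config N d (UnitAddTorus d)) (F : ℝ → Config k d (UnitAddTorus d))
    (e : Fin k → Fin N) : Set (Fin k) :=
  {m | ∃ t, 0 ≤ t ∧ Γ t (e m) ≠ F t m}

/-- The INFECTION TIME `τ_m`: the infimum of the times `t ≥ 0` at which the two states of `m`
differ (junk value `0` if `m` is never infected). -/
def infTime (Γ : ℝ → Config N d (UnitAddTorus d)) (F : ℝ → Config k d (UnitAddTorus d))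
    (e : Fin k → Fin N) (m : Fin k) : ℝ :=
  sInf {t : ℝ | 0 ≤ t ∧ Γ t (e m) ≠ F t m}

/-- The particles FRESH at `τ`: those whose two states agree on `[0, τ)`. -/
def fresh (Γ : ℝ → Config N d (UnitAddTorus d)) (F : ℝ → Config k d (UnitAddTorus d))
    (e : Fin k → Fin N) (τ : ℝ) : Set (Fin k) :=
  {m | ∀ t, 0 ≤ t → t < τ → Γ t (e m) = F t m}

end Defs

variable {Γ : ℝ → Config N d (UnitAddTorus d)} {F : ℝ → Config k d (UnitAddTorus d)}
  {e : Fin k → Fin N} {m : Fin k} {τ : ℝ}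

/-- Infection times are nonnegative. -/
theorem infTime_nonneg : 0 ≤ infTime Γ F e m := Real.sInf_nonneg fun _ h => h.1

/-- The infection time is at most any time of disagreement. -/
theorem infTime_le {t : ℝ} (ht : 0 ≤ t) (hne : Γ t (e m) ≠ F t m) : infTime Γ F e m ≤ t :=
  csInf_le ⟨0, fun _ h => h.1⟩ ⟨ht, hne⟩

/-- Before the infection time the two states agree. -/
theorem eq_of_lt_infTime {t : ℝ} (ht : 0 ≤ t) (hlt : t < infTime Γ F e m) : Γ t (e m) = F t m := by
  by_contra hne
  exact (not_le.2 hlt) (infTime_le ht hne)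

/-- Every particle is fresh at its own infection time. -/
theorem mem_fresh_infTime : m ∈ fresh Γ F e (infTime Γ F e m) :=
  fun _ ht hlt => eq_of_lt_infTime ht hlt

/-- A particle not infected strictly before `τ` is fresh at `τ`. -/
theorem mem_fresh_of_not (h : ¬ (m ∈ infected Γ F e ∧ infTime Γ F e m < τ)) :
    m ∈ fresh Γ F e τ := by
  intro t ht hlt
  by_contra hne
  exact h ⟨⟨t, ht, hne⟩, (infTime_le ht hne).trans_lt hlt⟩

/-- A fresh particle agrees in the two worlds on a left neighbourhood of `τ > 0`. -/
theorem eventuallyEq_of_mem_fresh (hfr : m ∈ fresh Γ F e τ) (hτ : 0 < τ) :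
    (fun t => Γ t (e m)) =ᶠ[𝓝[<] τ] fun t => F t m := by
  filter_upwards [Ioo_mem_nhdsLT hτ] with t ht
  exact hfr t ht.1.le ht.2

section Torus

variable [Fintype d]

/-! ## Contacts on the torus -/

/-- On the torus contact is symmetric in the pair. -/
theorem mem_contactSet_comm {M : ℕ} {z : Config M d (UnitAddTorus d)} {i j : Fin M} :
    z ∈ contactSet (Torus.geometry d) M ε i j ↔ z ∈ contactSet (Torus.geometry d) M ε j i := by
  rw [mem_contactSet, mem_contactSet, Torus.norm_geometry_sepVec, Torus.norm_geometry_sepVec,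
    Torus.euclidDist_comm]

/-- Contact only reads the two positions: it transfers between configurations (of possibly
different particle numbers) with the same two positions. -/
theorem mem_contactSet_of_fst_eq {M M' : ℕ} {z : Config M d (UnitAddTorus d)}
    {z' : Config M' d (UnitAddTorus d)} (hz' : z' ∈ hardSphereDomain (Torus.geometry d) M' ε)
    {a b : Fin M} {a' b' : Fin M'} (ha : (z a).1 = (z' a').1) (hb : (z b).1 = (z' b').1)
    (hc : z ∈ contactSet (Torus.geometry d) M ε a b) :
    z' ∈ contactSet (Torus.geometry d) M' ε a' b' :=
  ⟨hz', by rw [← ha, ← hb]; exact hc.2⟩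

/-- The elastic reflection only reads the two colliding states. -/
theorem collidePair_apply_eq_of_eq {M M' : ℕ} (zl : Config M d (UnitAddTorus d))
    (zl' : Config M' d (UnitAddTorus d)) {a b : Fin M} {a' b' : Fin M'} (hab : a ≠ b)
    (hab' : a' ≠ b') (ha : zl a = zl' a') (hb : zl b = zl' b') :
    collidePair (Torus.geometry d) a b zl a = collidePair (Torus.geometry d) a' b' zl' a' := by
  rw [collidePair_apply_left hab, collidePair_apply_left hab', ha, hb]

/-- Without a contact of particle `a` at time `τ`, the state of `a` does not jump at `τ`
(binary collisions only change the colliding pair). -/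
theorem apply_eq_leftLim_of_forall_not_contact {M : ℕ} {γ : ℝ → Config M d (UnitAddTorus d)}
    (hγ : IsHardSphereTrajectory (Torus.geometry d) ε M γ) {τ : ℝ} {a : Fin M}
    (hno : ∀ c, c ≠ a → γ τ ∉ contactSet (Torus.geometry d) M ε a c) :
    γ τ a = leftLim γ τ a := by
  by_cases hcol : τ ∈ collisionTimes (Torus.geometry d) ε γ
  · obtain ⟨i', j', hij, hc⟩ := hcol
    have hai : a ≠ i' := by
      rintro rfl
      exact hno j' hij.symm hc
    have haj : a ≠ j' := by
      rintro rfl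
      exact hno i' hij (mem_contactSet_comm.1 hc)
    obtain ⟨-, heq⟩ := hγ.eq_collidePair_leftLim hij hc
    rw [heq]
    exact collidePair_apply_of_ne hai haj _
  · exact (congrFun (hγ.leftLim_eq_of_not_mem Torus.continuous_geometry_translate hcol) a).symm

/-! ## The infection time is a contact time -/

/-- **The infection time is attained**: at `τ_m` the two states of an infected particle differ
(if they agreed at `τ_m`, both worlds being free flights on a right neighbourhood of `τ_m`, they
would agree a bit longer). -/
theorem ne_at_infTime (hΓ : IsHardSphereTrajectory (Torus.geometry d) ε N Γ)
    (hF : IsHardSphereTrajectory (Torus.geometry d) ε k F) (hinf : m ∈ infected Γ F e) :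
    Γ (infTime Γ F e m) (e m) ≠ F (infTime Γ F e m) m := by
  set τ₀ := infTime Γ F e m with hτ₀
  intro heq
  obtain ⟨u₁, hu₁, hfree₁⟩ := hΓ.exists_Ioo_right_free τ₀
  obtain ⟨u₂, hu₂, hfree₂⟩ := hF.exists_Ioo_right_free τ₀
  have hagree : ∀ t, 0 ≤ t → t < min u₁ u₂ → Γ t (e m) = F t m := by
    intro t ht htu
    rcases lt_or_ge t τ₀ with hlt | hge
    · exact eq_of_lt_infTime ht hlt
    · have h1 : Γ t = freeFlight (Torus.geometry d) (t - τ₀) (Γ τ₀) :=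
        hΓ.eq_freeFlight_of_Ioo_free hfree₁ ⟨hge, htu.trans_le (min_le_left _ _)⟩
      have h2 : F t = freeFlight (Torus.geometry d) (t - τ₀) (F τ₀) :=
        hF.eq_freeFlight_of_Ioo_free hfree₂ ⟨hge, htu.trans_le (min_le_right _ _)⟩
      rw [h1, h2, freeFlight_apply, freeFlight_apply, heq]
  obtain ⟨t, ht, hne⟩ := hinf
  have hne' : {t : ℝ | 0 ≤ t ∧ Γ t (e m) ≠ F t m}.Nonempty := ⟨t, ht, hne⟩
  have hle : min u₁ u₂ ≤ τ₀ := by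
    refine le_csInf hne' fun s hs => ?_
    by_contra hlt
    push Not at hlt
    exact hs.2 (hagree s hs.1 hlt)
  exact (lt_min hu₁ hu₂).not_ge hle

/-- Infection times are positive (the two worlds start from the same states). -/
theorem infTime_pos (hΓ : IsHardSphereTrajectory (Torus.geometry d) ε N Γ)
    (hF : IsHardSphereTrajectory (Torus.geometry d) ε k F) (h0 : ∀ m, F 0 m = Γ 0 (e m))
    (hinf : m ∈ infected Γ F e) : 0 < infTime Γ F e m := by
  rcases (infTime_nonneg (Γ := Γ) (F := F) (e := e) (m := m)).eq_or_lt with h | h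
  · exact absurd ((congrArg (fun s => Γ s (e m)) h.symm).trans
      ((h0 m).symm.trans (congrArg (fun s => F s m) h))) (ne_at_infTime hΓ hF hinf)
  · exact h

/-- A fresh particle has the same position in both worlds at `τ` (positions are continuous). -/
theorem fst_eq_of_mem_fresh (hΓ : IsHardSphereTrajectory (Torus.geometry d) ε N Γ)
    (hF : IsHardSphereTrajectory (Torus.geometry d) ε k F) (hfr : m ∈ fresh Γ F e τ)
    (hτ : 0 < τ) : (Γ τ (e m)).1 = (F τ m).1 := by
  have h1 : Tendsto (fun t => (Γ t (e m)).1) (𝓝[<] τ) (𝓝 (Γ τ (e m)).1) :=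
    ((hΓ.pos_continuous (e m)).tendsto τ).mono_left nhdsWithin_le_nhds
  have h2 : Tendsto (fun t => (F t m).1) (𝓝[<] τ) (𝓝 (F τ m).1) :=
    ((hF.pos_continuous m).tendsto τ).mono_left nhdsWithin_le_nhds
  have heq : (fun t => (Γ t (e m)).1) =ᶠ[𝓝[<] τ] fun t => (F t m).1 :=
    (eventuallyEq_of_mem_fresh hfr hτ).mono fun t ht => by simp only [ht]
  exact tendsto_nhds_unique (h1.congr' heq) h2

/-- A fresh particle has the same left limit (pre-collisional state) in both worlds at `τ`. -/
theorem leftLim_eq_of_mem_fresh (hΓ : IsHardSphereTrajectory (Torus.geometry d) ε N Γ)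
    (hF : IsHardSphereTrajectory (Torus.geometry d) ε k F) (hfr : m ∈ fresh Γ F e τ)
    (hτ : 0 < τ) : leftLim Γ τ (e m) = leftLim F τ m := by
  have h1 : Tendsto (fun t => Γ t (e m)) (𝓝[<] τ) (𝓝 (leftLim Γ τ (e m))) :=
    ((continuous_apply (e m)).tendsto _).comp
      (hΓ.tendsto_leftLim Torus.continuous_geometry_translate τ)
  have h2 : Tendsto (fun t => F t m) (𝓝[<] τ) (𝓝 (leftLim F τ m)) :=
    ((continuous_apply m).tendsto _).comp
      (hF.tendsto_leftLim Torus.continuous_geometry_translate τ)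
  exact tendsto_nhds_unique (h1.congr' (eventuallyEq_of_mem_fresh hfr hτ)) h2

/-- Two particles fresh at `τ > 0` that touch in one world touch in the other. -/
theorem contact_iff_of_mem_fresh (hΓ : IsHardSphereTrajectory (Torus.geometry d) ε N Γ)
    (hF : IsHardSphereTrajectory (Torus.geometry d) ε k F) {m' : Fin k} (hfr : m ∈ fresh Γ F e τ)
    (hfr' : m' ∈ fresh Γ F e τ) (hτ : 0 < τ) :
    Γ τ ∈ contactSet (Torus.geometry d) N ε (e m) (e m') ↔
      F τ ∈ contactSet (Torus.geometry d) k ε m m' :=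
  ⟨mem_contactSet_of_fst_eq (hF.mem τ) (fst_eq_of_mem_fresh hΓ hF hfr hτ)
      (fst_eq_of_mem_fresh hΓ hF hfr' hτ),
    mem_contactSet_of_fst_eq (hΓ.mem τ) (fst_eq_of_mem_fresh hΓ hF hfr hτ).symm
      (fst_eq_of_mem_fresh hΓ hF hfr' hτ).symm⟩

/-- **A contact between two fresh particles does not infect**: if at `τ > 0` the fresh
particles `m ≠ m'` touch (in `Γ`, equivalently in `F`), the post-collisional states of `m`
agree (same pre-collisional pair of states, same reflection). -/
theorem apply_eq_of_contact_of_mem_fresh (hΓ : IsHardSphereTrajectory (Torus.geometry d) ε N Γ)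
    (hF : IsHardSphereTrajectory (Torus.geometry d) ε k F) (he : Injective e) {m' : Fin k}
    (hfr : m ∈ fresh Γ F e τ) (hfr' : m' ∈ fresh Γ F e τ) (hτ : 0 < τ) (hne : m ≠ m')
    (hc : Γ τ ∈ contactSet (Torus.geometry d) N ε (e m) (e m')) : Γ τ (e m) = F τ m := by
  have hc' : F τ ∈ contactSet (Torus.geometry d) k ε m m' :=
    (contact_iff_of_mem_fresh hΓ hF hfr hfr' hτ).1 hc
  obtain ⟨-, hΓeq⟩ := hΓ.eq_collidePair_leftLim (he.ne hne) hc
  obtain ⟨-, hFeq⟩ := hF.eq_collidePair_leftLim hne hc'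
  rw [hΓeq, hFeq]
  exact collidePair_apply_eq_of_eq _ _ (he.ne hne) hne (leftLim_eq_of_mem_fresh hΓ hF hfr hτ)
    (leftLim_eq_of_mem_fresh hΓ hF hfr' hτ)

/-- **NoSourceNoBadness: every infection is a contact with a source.** At the infection time
`τ_m` of an infected particle `m`, either `m` touches in the true world an OUTSIDER
`c ∉ range e`, or there is a CARRIER `m' ≠ m`, infected strictly earlier, touching `m` in the
true world or in the forecast world. -/
theorem exists_carrier (hΓ : IsHardSphereTrajectory (Torus.geometry d) ε N Γ)
    (hF : IsHardSphereTrajectory (Torus.geometry d) ε k F) (h0 : ∀ m, F 0 m = Γ 0 (e m))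
    (he : Injective e) (hinf : m ∈ infected Γ F e) :
    (∃ c, c ∉ Set.range e ∧
        Γ (infTime Γ F e m) ∈ contactSet (Torus.geometry d) N ε (e m) c) ∨
      ∃ m', m' ≠ m ∧ m' ∈ infected Γ F e ∧ infTime Γ F e m' < infTime Γ F e m ∧
        (Γ (infTime Γ F e m) ∈ contactSet (Torus.geometry d) N ε (e m) (e m') ∨
          F (infTime Γ F e m) ∈ contactSet (Torus.geometry d) k ε m m') := by
  set τ₀ := infTime Γ F e m with hτ₀
  have hτ : 0 < τ₀ := infTime_pos hΓ hF h0 hinf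
  have hfr : m ∈ fresh Γ F e τ₀ := mem_fresh_infTime
  have hne : Γ τ₀ (e m) ≠ F τ₀ m := ne_at_infTime hΓ hF hinf
  by_cases hcon : ∃ c, c ≠ e m ∧ Γ τ₀ ∈ contactSet (Torus.geometry d) N ε (e m) c
  · obtain ⟨c, hcm, hc⟩ := hcon
    by_cases hcS : c ∈ Set.range e
    · obtain ⟨m', rfl⟩ := hcS
      have hmm : m' ≠ m := fun h => hcm (congrArg e h)
      refine Or.inr ⟨m', hmm, ?_⟩
      by_contra hnot
      have hfr' : m' ∈ fresh Γ F e τ₀ := mem_fresh_of_not fun h => hnot ⟨h.1, h.2, Or.inl hc⟩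
      exact hne (apply_eq_of_contact_of_mem_fresh hΓ hF he hfr hfr' hτ hmm.symm hc)
    · exact Or.inl ⟨c, hcS, hc⟩
  · push Not at hcon
    -- no contact of `e m` in `Γ` at `τ₀`: the true state of `m` does not jump
    have hΓl : Γ τ₀ (e m) = leftLim Γ τ₀ (e m) :=
      apply_eq_leftLim_of_forall_not_contact hΓ fun c hc => hcon c hc
    -- hence the forecast state of `m` jumps: a contact of `m` in `F`
    have hFj : F τ₀ m ≠ leftLim F τ₀ m := by
      rw [← leftLim_eq_of_mem_fresh hΓ hF hfr hτ, ← hΓl]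
      exact hne.symm
    obtain ⟨m', hmm, hc'⟩ : ∃ m', m' ≠ m ∧ F τ₀ ∈ contactSet (Torus.geometry d) k ε m m' := by
      by_contra hall
      push Not at hall
      exact hFj (apply_eq_leftLim_of_forall_not_contact hF fun c hc => hall c hc)
    refine Or.inr ⟨m', hmm, ?_⟩
    by_contra hnot
    have hfr' : m' ∈ fresh Γ F e τ₀ := mem_fresh_of_not fun h => hnot ⟨h.1, h.2, Or.inr hc'⟩
    exact hcon (e m') (he.ne hmm) ((contact_iff_of_mem_fresh hΓ hF hfr hfr' hτ).2 hc')

/-- **Registered prelim statement** (stub `stub_anchoredCovering`, NoSourceNoBadness): every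
infection is a contact with an outsider or with a strictly earlier infected carrier, in the true
or in the forecast world. -/
theorem anchoredCovering_noSourceNoBadness : ∀ {d : Type} [Fintype d] {ε : ℝ} {N k : ℕ} {Γ : ℝ → Config N d (UnitAddTorus d)} {F : ℝ → Config k d (UnitAddTorus d)} {e : Fin k → Fin N} {m : Fin k}, IsHardSphereTrajectory (Torus.geometry d) ε N Γ → IsHardSphereTrajectory (Torus.geometry d) ε k F → (∀ m, F 0 m = Γ 0 (e m)) → Function.Injective e → m ∈ infected Γ F e → (∃ c, c ∉ Set.range e ∧ Γ (infTime Γ F e m) ∈ contactSet (Torus.geometry d) N ε (e m) c) ∨ ∃ m', m' ≠ m ∧ m' ∈ infected Γ F e ∧ infTime Γ F e m' < infTime Γ F e m ∧ (Γ (infTime Γ F e m) ∈ contactSet (Torus.geometry d) N ε (e m) (e m') ∨ F (infTime Γ F e m) ∈ contactSet (Torus.geometry d) k ε m m') :=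
  fun hΓ hF h0 he hinf => exists_carrier hΓ hF h0 he hinf

end Torus

end

end Summit.AtomisticToContinuum.HydrodynamicLimit.Theorems.TrueAnchoredInfection
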